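import Mathlib.Data.Bool.Count
import Literature.MathematicalPhysics.QuantumLattice.KomaTasakiTowerState

/-!
# Koma–Tasaki 1994, Theorem 2.4: the averaging identity (OBO1)–(OBO2)

Towards the proof of the named fact `theorem_2_4` of `KomaTasakiSSB.lean` (T. Koma, H. Tasaki,
J. Stat. Phys. **76** (1994) 745–803, `KomaTasaki1994`, Section 5, proof of Lemma `hardLemma`).

KT (OBO1)–(OBO2): for an operator `B` commuting with `C` and a state with `C Φ = 0`,
`c_J ⟨Φ, (O⁽¹⁾)^J B (O⁽¹⁾)^J Φ⟩ = binom(2J, J)⁻¹ Σ_{τ : Σ τ_i = 0} ⟨Φ, (Π_{i ≤ J} O^{τ_i}) B (Π_{i > J} O^{τ_i}) Φ⟩`,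
obtained by expanding `O⁽¹⁾ = (O⁺ + O⁻)/2` (the non-commutative binomial expansion
`(O⁺ + O⁻)^J = Σ_{τ ∈ {±}^J} Π_τ`, `sum_wordOp_ofFn`), discarding the words of nonzero total charge
("the constraint comes from the fact that `Φ` is an eigenstate of the `U(1)` generator `C`"), and
counting the surviving words: `#{τ ∈ {±}^{2J} : Σ τ_i = 0} = binom(2J, J)` (`card_pairFilter`).
We index the words of length `2J` as pairs of words of length `J` (`Fin J → Bool`).
The consequence used in the proof of Lemma `hardLemma` is `norm_sub_cCoef_mul_inner_le`: anything within
`δ` of every surviving term is within `δ` of `c_J ⟨Φ, (O⁽¹⁾)^J B (O⁽¹⁾)^J Φ⟩`.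

Locators: equation labels such as `(bmDef)`, `(K+Lcond)`, `(dBound1)`, `(OBO2)`, `(Bunshi)` and the
lemma names `easyLemma`/`hardLemma`/`subLemma` (the three lemmas of §5, in this order) are those
of the arXiv source cond-mat/9708132 of `KomaTasaki1994`.

Consumers (2026-08-29): `AndersonTowerOfStatesUnconditional.lean` (KT94 Corollary 2.11 for the Heisenberg antiferromagnet
and hard-core bosons) via `KomaTasakiTowerHardLemma.lean` / `KomaTasakiSSBTowerProofs.lean`.
-/

noncomputable section

open Complex Finset
open scoped InnerProductSpace ComplexConjugate

namespace Literature.MathematicalPhysics.QuantumLattice.KomaTasaki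

universe u v

variable {Λ : Type u} [Fintype Λ] {E : Type v} [NormedAddCommGroup E] [InnerProductSpace ℂ E]

/-! ### Counting words with a prescribed number of `+` -/

section Counting

omit [Fintype Λ]

/-- A sum over words of length `n + 1` splits according to the first letter. [folklore] -/
theorem sum_fin_succ_bool {M : Type*} [AddCommMonoid M] {n : ℕ} (f : (Fin (n + 1) → Bool) → M) :
    ∑ τ : Fin (n + 1) → Bool, f τ =
      ∑ τ : Fin n → Bool, f (Fin.cons true τ) + ∑ τ : Fin n → Bool, f (Fin.cons false τ) := by
  rw [← (Fin.consEquiv fun _ : Fin (n + 1) => Bool).sum_comp, Fintype.sum_prod_type,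
    Fintype.sum_bool]
  rfl

/-- The number of `+` in a word is at most its length. [folklore] -/
theorem count_ofFn_le {n : ℕ} (τ : Fin n → Bool) (b : Bool) : (List.ofFn τ).count b ≤ n := by
  simpa using List.count_le_length (a := b) (l := List.ofFn τ)

/-- The charge of a word of length `n` with `k` letters `+` is `2k - n`. [folklore] -/
theorem wordCharge_ofFn {n : ℕ} (τ : Fin n → Bool) :
    U1System.wordCharge (List.ofFn τ) = 2 * ((List.ofFn τ).count true : ℤ) - n := by
  have h := List.count_true_add_count_false (List.ofFn τ)
  rw [List.length_ofFn] at h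
  rw [U1System.wordCharge]
  omega

/-- `#⁺(- :: l) = #⁺(l)`. [folklore] -/
theorem count_true_cons_false (l : List Bool) : (false :: l).count true = l.count true := by simp

/-- **Counting:** `#{τ : Fin n → Bool | #⁺(τ) = k} = binom(n, k)`, in summatory form. [folklore] -/
theorem sum_ite_count_eq_choose (n k : ℕ) :
    (∑ τ : Fin n → Bool, if (List.ofFn τ).count true = k then (1 : ℕ) else 0) = n.choose k := by
  induction n generalizing k with
  | zero =>
      cases k with
      | zero => simp
      | succ k => simp
  | succ n ih =>
      rw [sum_fin_succ_bool]
      simp only [List.ofFn_cons, List.count_cons_self, count_true_cons_false]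
      cases k with
      | zero =>
          have h0 : ∀ τ : Fin n → Bool,
              (if (List.ofFn τ).count true + 1 = 0 then (1 : ℕ) else 0) = 0 := fun τ => by
            rw [if_neg]; omega
          simp only [h0, Finset.sum_const_zero, zero_add, Nat.choose_zero_right]
          rw [ih 0, Nat.choose_zero_right]
      | succ k =>
          simp only [Nat.add_right_cancel_iff]
          rw [ih k, ih (k + 1), Nat.choose_succ_succ']

/-- **Counting:** `#{τ : Fin n → Bool | #⁺(τ) = k} = binom(n, k)`. [folklore] -/
theorem card_filter_count_eq_choose (n k : ℕ) :
    (univ.filter fun τ : Fin n → Bool => (List.ofFn τ).count true = k).card = n.choose k := by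
  rw [Finset.card_filter, sum_ite_count_eq_choose]

/-- **Counting the words of charge zero:** `#{(τ₁, τ₂) : #⁺(τ₁) + #⁺(τ₂) = J} = binom(2J, J)`
(Vandermonde). [cite: KomaTasaki1994, §5 (OBO2)] -/
theorem card_pairFilter (J : ℕ) :
    (univ.filter (fun p : (Fin J → Bool) × (Fin J → Bool) =>
        (List.ofFn p.1).count true + (List.ofFn p.2).count true = J)).card = Nat.centralBinom J := by
  rw [Finset.card_filter, Fintype.sum_prod_type]
  simp only
  -- inner sum: `#{τ₂ : #⁺τ₂ = J - #⁺τ₁} = binom(J, J - #⁺τ₁)`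
  have h1 : ∀ τ₁ : Fin J → Bool,
      (∑ τ₂ : Fin J → Bool,
        if (List.ofFn τ₁).count true + (List.ofFn τ₂).count true = J then 1 else 0) =
      J.choose (J - (List.ofFn τ₁).count true) := by
    intro τ₁
    rw [← sum_ite_count_eq_choose]
    refine Finset.sum_congr rfl fun τ₂ _ => ?_
    have := count_ofFn_le τ₁ true
    congr 1
    apply propext
    omega
  simp_rw [h1]
  -- fiberwise over the value of `#⁺τ₁`
  rw [← Finset.sum_fiberwise_of_maps_to (s := (univ : Finset (Fin J → Bool)))
    (t := Finset.range (J + 1)) (g := fun τ₁ => (List.ofFn τ₁).count true)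
    (fun τ₁ _ => Finset.mem_range.mpr (Nat.lt_succ_of_le (count_ofFn_le τ₁ true)))]
  have h2 : ∀ k ∈ Finset.range (J + 1),
      (∑ τ₁ ∈ (univ : Finset (Fin J → Bool)) with (List.ofFn τ₁).count true = k,
        J.choose (J - (List.ofFn τ₁).count true)) = J.choose k * J.choose (J - k) := by
    intro k _
    rw [Finset.sum_congr rfl (g := fun _ => J.choose (J - k))
      (fun τ₁ hτ => by rw [(Finset.mem_filter.mp hτ).2]), Finset.sum_const, smul_eq_mul,
      card_filter_count_eq_choose]
  rw [Finset.sum_congr rfl h2, ← Finset.Nat.sum_antidiagonal_eq_sum_range_succ_mk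
    (f := fun ij => J.choose ij.1 * J.choose ij.2), ← Nat.add_choose_eq, Nat.centralBinom,
    two_mul]

end Counting

namespace U1System

variable (sys : U1System Λ E)

/-! ### The non-commutative binomial expansion of `(O⁺ + O⁻)^J` -/

/-- `(O⁺ + O⁻)^J = Σ_{τ ∈ {±}^J} Π_τ`. [cite: KomaTasaki1994, §5 (OBO1)] -/
theorem sum_wordOp_ofFn (J : ℕ) :
    ∑ τ : Fin J → Bool, sys.wordOp (List.ofFn τ) = (sys.orderPlus + sys.orderMinus) ^ J := by
  induction J with
  | zero => simp
  | succ J ih =>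
      rw [sum_fin_succ_bool]
      simp only [List.ofFn_cons, wordOp_cons, sgnOp_true, sgnOp_false, ← Finset.mul_sum, ih,
        pow_succ', add_mul]

/-- `O⁽¹⁾ = ½ (O⁺ + O⁻)`. [cite: KomaTasaki1994, §5 (OBO1)] -/
theorem order_zero_eq_smul : sys.order 0 = (2⁻¹ : ℂ) • (sys.orderPlus + sys.orderMinus) := by
  rw [orderPlus, orderMinus]
  module

/-- `(O⁽¹⁾)^J = 2^{-J} Σ_{τ ∈ {±}^J} Π_τ`. [cite: KomaTasaki1994, §5 (OBO1)] -/
theorem order_zero_pow (J : ℕ) :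
    sys.order 0 ^ J = (2⁻¹ : ℂ) ^ J • ∑ τ : Fin J → Bool, sys.wordOp (List.ofFn τ) := by
  rw [order_zero_eq_smul, smul_pow, sum_wordOp_ofFn]

/-! ### The averaging identity -/

/-- Expansion of the sandwich: `4^J ⟨Φ, (O⁽¹⁾)^J B (O⁽¹⁾)^J Φ⟩ = Σ_{τ₁, τ₂} ⟨Φ, Π_{τ₁} B Π_{τ₂} Φ⟩`.
[cite: KomaTasaki1994, §5 (OBO1)] -/
theorem four_pow_mul_inner_sandwich (B : E →L[ℂ] E) (J : ℕ) (Φ : E) :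
    (4 : ℂ) ^ J * ⟪Φ, (sys.order 0 ^ J * B * sys.order 0 ^ J) Φ⟫_ℂ =
      ∑ p : (Fin J → Bool) × (Fin J → Bool),
        ⟪Φ, (sys.wordOp (List.ofFn p.1) * B * sys.wordOp (List.ofFn p.2)) Φ⟫_ℂ := by
  set W : E →L[ℂ] E := ∑ τ : Fin J → Bool, sys.wordOp (List.ofFn τ) with hW
  have e1 : ((2⁻¹ : ℂ) ^ J • W) * B * ((2⁻¹ : ℂ) ^ J • W) =
      ((2⁻¹ : ℂ) ^ J * (2⁻¹ : ℂ) ^ J) • (W * B * W) := by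
    rw [smul_mul_assoc, smul_mul_assoc, mul_smul_comm, smul_smul]
  rw [order_zero_pow, ← hW, e1, smul_apply, inner_smul_right, ← mul_assoc, ← mul_pow, ← mul_pow]
  have h4 : (4 * (2⁻¹ * 2⁻¹) : ℂ) = 1 := by norm_num
  rw [h4, one_pow, one_mul, hW, Finset.sum_mul, Finset.sum_mul]
  simp only [Finset.mul_sum, FunLike.coe_sum, Finset.sum_apply, inner_sum]
  rw [Fintype.sum_prod_type]

/-- Words of nonzero total charge do not contribute: for `[C, B] = 0` and `C Φ = 0`, if
`⟨Φ, Π_{τ₁} B Π_{τ₂} Φ⟩ ≠ 0` then `#⁺(τ₁) + #⁺(τ₂) = J`. [cite: KomaTasaki1994, §5 (OBO1)] -/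
theorem count_add_count_eq_of_inner_ne_zero {B : E →L[ℂ] E} (hB : sys.HasCharge B 0) {Φ : E}
    (hΦ : sys.C Φ = 0) {J : ℕ} (τ₁ τ₂ : Fin J → Bool)
    (h : ⟪Φ, (sys.wordOp (List.ofFn τ₁) * B * sys.wordOp (List.ofFn τ₂)) Φ⟫_ℂ ≠ 0) :
    (List.ofFn τ₁).count true + (List.ofFn τ₂).count true = J := by
  by_contra hne
  apply h
  have hc := ((sys.hasCharge_wordOp (List.ofFn τ₁)).mul hB).mul (sys.hasCharge_wordOp (List.ofFn τ₂))
  refine hc.inner_eq_zero ?_ hΦ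
  rw [wordCharge_ofFn, wordCharge_ofFn]
  omega

/-- **The averaging identity (OBO1)–(OBO2), unnormalised:** for `[C, B] = 0` and `C Φ = 0`,
`4^J ⟨Φ, (O⁽¹⁾)^J B (O⁽¹⁾)^J Φ⟩ = Σ_{(τ₁,τ₂) : #⁺ = J} ⟨Φ, Π_{τ₁} B Π_{τ₂} Φ⟩`.
[cite: KomaTasaki1994, §5 (OBO1)–(OBO2)] -/
theorem four_pow_mul_inner_sandwich_eq_sum_filter {B : E →L[ℂ] E} (hB : sys.HasCharge B 0) {Φ : E}
    (hΦ : sys.C Φ = 0) (J : ℕ) :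
    (4 : ℂ) ^ J * ⟪Φ, (sys.order 0 ^ J * B * sys.order 0 ^ J) Φ⟫_ℂ =
      ∑ p ∈ univ.filter (fun p : (Fin J → Bool) × (Fin J → Bool) =>
          (List.ofFn p.1).count true + (List.ofFn p.2).count true = J),
        ⟪Φ, (sys.wordOp (List.ofFn p.1) * B * sys.wordOp (List.ofFn p.2)) Φ⟫_ℂ := by
  rw [four_pow_mul_inner_sandwich, Finset.sum_filter_of_ne]
  intro p _ hp
  exact sys.count_add_count_eq_of_inner_ne_zero hB hΦ p.1 p.2 hp

/-- **Consequence used in Lemma `hardLemma` (the step (OBO2)):** if `T₀` is within `δ` of every charge-zero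
term `⟨Φ, Π_{τ₁} B Π_{τ₂} Φ⟩`, then `|T₀ - c_J ⟨Φ, (O⁽¹⁾)^J B (O⁽¹⁾)^J Φ⟩| ≤ δ`
(`c_J = 4^J / binom(2J, J)`, and there are exactly `binom(2J, J)` such terms).
[cite: KomaTasaki1994, §5 (OBO2)] -/
theorem norm_sub_cCoef_mul_inner_le {B : E →L[ℂ] E} (hB : sys.HasCharge B 0) {Φ : E}
    (hΦ : sys.C Φ = 0) (J : ℕ) (T₀ : ℂ) {δ : ℝ}
    (h : ∀ τ₁ τ₂ : Fin J → Bool, (List.ofFn τ₁).count true + (List.ofFn τ₂).count true = J →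
      ‖T₀ - ⟪Φ, (sys.wordOp (List.ofFn τ₁) * B * sys.wordOp (List.ofFn τ₂)) Φ⟫_ℂ‖ ≤ δ) :
    ‖T₀ - (cCoef J : ℂ) * ⟪Φ, (sys.order 0 ^ J * B * sys.order 0 ^ J) Φ⟫_ℂ‖ ≤ δ := by
  have hsum := sys.four_pow_mul_inner_sandwich_eq_sum_filter hB hΦ J
  have hcard := card_pairFilter J
  set S := univ.filter (fun p : (Fin J → Bool) × (Fin J → Bool) =>
    (List.ofFn p.1).count true + (List.ofFn p.2).count true = J)
  have hpos : (0 : ℝ) < S.card := by rw [hcard]; exact_mod_cast Nat.centralBinom_pos J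
  -- `c_J ⟨…⟩ = |S|⁻¹ Σ_{p ∈ S} t_p`
  have hc : (cCoef J : ℂ) * ⟪Φ, (sys.order 0 ^ J * B * sys.order 0 ^ J) Φ⟫_ℂ =
      ((S.card : ℝ) : ℂ)⁻¹ * ∑ p ∈ S,
        ⟪Φ, (sys.wordOp (List.ofFn p.1) * B * sys.wordOp (List.ofFn p.2)) Φ⟫_ℂ := by
    rw [← hsum, ← mul_assoc, cCoef_def, hcard]
    push_cast
    ring
  -- `T₀ = |S|⁻¹ Σ_{p ∈ S} T₀`
  have hT : T₀ = ((S.card : ℝ) : ℂ)⁻¹ * ∑ _p ∈ S, T₀ := by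
    rw [Finset.sum_const, nsmul_eq_mul, ← mul_assoc]
    have : ((S.card : ℝ) : ℂ) ≠ 0 := by exact_mod_cast hpos.ne'
    rw [show ((S.card : ℝ) : ℂ) = (S.card : ℂ) by push_cast; rfl] at this ⊢
    rw [inv_mul_cancel₀ this, one_mul]
  rw [hc]
  conv_lhs => rw [hT]
  rw [← mul_sub, ← Finset.sum_sub_distrib, norm_mul, norm_inv]
  have hn : ‖((S.card : ℝ) : ℂ)‖ = S.card := by
    rw [Complex.norm_real, Real.norm_eq_abs, abs_of_pos hpos]
  rw [hn]
  calc (S.card : ℝ)⁻¹ * ‖∑ p ∈ S, (T₀ -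
          ⟪Φ, (sys.wordOp (List.ofFn p.1) * B * sys.wordOp (List.ofFn p.2)) Φ⟫_ℂ)‖
      ≤ (S.card : ℝ)⁻¹ * ∑ p ∈ S, ‖T₀ -
          ⟪Φ, (sys.wordOp (List.ofFn p.1) * B * sys.wordOp (List.ofFn p.2)) Φ⟫_ℂ‖ :=
        mul_le_mul_of_nonneg_left (norm_sum_le _ _) (inv_nonneg.mpr hpos.le)
    _ ≤ (S.card : ℝ)⁻¹ * ∑ _p ∈ S, δ :=
        mul_le_mul_of_nonneg_left (Finset.sum_le_sum fun p hp =>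
          h p.1 p.2 ((mem_filter_univ p).mp hp)) (inv_nonneg.mpr hpos.le)
    _ = δ := by
        rw [Finset.sum_const, nsmul_eq_mul, ← mul_assoc, inv_mul_cancel₀ hpos.ne', one_mul]

/-- `c_J |⟨Φ, (O⁽¹⁾)^J B (O⁽¹⁾)^J Φ⟩| ≤ ‖B‖ b_J` (KT, the norm estimate proving (dBound2)). [cite: KomaTasaki1994, §5 proof of (dBound2)] -/
theorem cCoef_mul_norm_inner_sandwich_le (B : E →L[ℂ] E) (J : ℕ) (Φ : E) :
    cCoef J * ‖⟪Φ, (sys.order 0 ^ J * B * sys.order 0 ^ J) Φ⟫_ℂ‖ ≤ ‖B‖ * bm sys Φ J := by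
  rw [bm_eq]
  have h := norm_inner_sandwich_le (sys.isSymmetric_order 0) B J Φ
  have hc := (cCoef_pos J).le
  calc cCoef J * ‖⟪Φ, (sys.order 0 ^ J * B * sys.order 0 ^ J) Φ⟫_ℂ‖
      ≤ cCoef J * (‖B‖ * ‖(sys.order 0 ^ J) Φ‖ ^ 2) := mul_le_mul_of_nonneg_left h hc
    _ = ‖B‖ * (cCoef J * ‖(sys.order 0 ^ J) Φ‖ ^ 2) := by ring

end U1System

end Literature.MathematicalPhysics.QuantumLattice.KomaTasaki
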